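import Literature.IUT.HodgeArakelov.BadPlaceSettingOfUnderline
import Literature.IUT.HodgeArakelov.EtaleThetaDataOfSettingCor218i
import Literature.IUT.HodgeArakelov.EtaleThetaDataOfSettingProp24
import HarnessLib

/-!
# [IUTchII] Prop. 2.1 well-definedness AT THE PRINT-LEVEL MODEL `BadPlaceSetting.ofUnderline` (proof-only
# compositions): modulo [EtTh] Cor. 2.18 (i) BY NAME · modulo [EtTh] Prop. 2.4 (i) at the model · the `Y`-row
# modulo only the compact-generation binder

S. Mochizuki, *Inter-universal Teichmüller theory II*, kurims manuscript (Dec. 2020) §2, Prop. 2.1 pp. 64–65,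
Rmk. 2.1.1 (i) p. 65, Def. 2.3 (i) p. 67 (claim key `Mochizuki2012`, DISPUTED, D-0012); [EtTh] Prop. 2.4 (i)
p. 38, Cor. 2.18 (i) p. 56 [cite: MochizukiEtTh2009, Cor 2.18(i) p.56]. abc-iut cell (D-0067 wave 4), seat
abc-iut-w4-d034 gen 3 (lineage owner of `BadPlaceSettingOfDoubleUnderline.lean`); cone of [IUTchIII] Cor. 3.12,
DAG node **IUTchII:Prop2.1**; finding F-L6t19g5-1 (abc-iut-L6-t19 gen 5: print's "`X_v`" at `v ∈ 𝕍^bad` is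
`X̲_v` of type `(1, l-tors)`, so the PRINT-LEVEL model bad-place setting is abc-iut-L6-t19's
`BadPlaceSetting.ofUnderline`, `Π^tp_{X_v} := Π^tp_{X̲_v} = D.GtpXu l`, `[Π^tp_{X_v} : Π_v] = l`). PROOF-ONLY:
no definition, no new named fact; nothing landed is edited.

WHAT THIS FILE DOES. It RE-POINTS the three existing kernel routes to "[IUTchII] Prop. 2.1 is well defined at
the [EtTh] model" from the `(1,1)`-ambient variant `BadPlaceSetting.ofDoubleUnderline` (abc-iut-w4-d034 gen 0,
p413302) onto the print-level model `BadPlaceSetting.ofUnderline` (abc-iut-L6-t19, p420095). The two records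
have the same `Π_v = Π^tp_X̲̲ = C.Huu` and the SAME pair of reference subgroups `Π_v ∩ Π^tp_{Ÿ_v}`,
`Π_v ∩ Π^tp_{Y_v}` of `Π_v` (`ofUnderline_refYdd_comap`, `ofUnderline_refY_comap`, both `rfl`), so every
route transfers verbatim:
* ROUTE A (FACT by name): `TemperedCoverings.YL_eq_of_cor218_i'` — modulo [EtTh] Cor. 2.18 (i)
  (`RigidData.Cor218_i` at abc-iut-L2-t8's `C.rigidData …`, FACT-LIST row, hypothesis BY NAME), via
  abc-iut-w4-d013's `EtaleThetaDataOfSetting.piYddCharacteristic_of_cor218_i` (p412812);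
* ROUTE B (the input print cites): `TemperedCoverings.YL_eq_of_prop24Model'` — modulo the [EtTh]
  Prop. 2.4 (i) extension binder at the model (`hP24`, GAP-LEDGER G-L6d6-2), via abc-iut-L6-d6's
  `EtaleThetaDataOfSetting.piYddCharacteristic_of_prop24` (p419393);
* ROUTE C (NEW consequence, `Y`-row only): `TemperedCoverings.YL_eq_of_compactlyGenerated'` (and the unprimed
  form for `ofDoubleUnderline`) — the `Π^tp_{Y̲_v}`-row of Prop. 2.1 is well defined at the model modulo ONLY the
  compact-generation binder `hYuu` (G-L6d6-1, the `X̲̲`-reading of the printed DEFINITION of `Z`, [EtTh] §1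
  p. 12), with NO anabelian input: abc-iut-L6-d6's `map_GtpY_subgroupOf_eq_of_compactlyGenerated` composed with
  the generic `Y`-row half `TemperedCoverings.YL_eq_of_isTopCharacteristic_refY` of abc-iut-w4-d010's
  `TemperedCoverings.YL_eq_of_characteristic` (p411925), proved here.

[claim: Mochizuki2012, status: disputed] Nothing here takes a side on [IUTchIII] Cor. 3.12; nothing asserts
[EtTh] Cor. 2.18 (i) or Prop. 2.4; typed ≠ proved.
-/

noncomputable section

namespace Literature.IUT.HodgeArakelov

open Literature.AnabelianGeometry.EtaleTheta

/-! ## 0. The `Y`-row half of well-definedness, over any bad-place setting (generic) -/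

section Generic

universe u

variable {S : BadPlaceSetting.{u}} {P : TopGroup.{u}}

/-- **IUTchII:Prop2.1**, well-definedness of the `Π^tp_{Y̲_v}`-ROW ALONE: if the reference subgroup
`Π^tp_{Y̲_v} = Π^tp_{Y_v} ∩ Π^tp_{X̲̲_v}` is stable under every automorphism of the topological group
`Π_v = Π^tp_{X̲̲_v}`, then any two Prop. 2.1 outputs over the same `P` have the same `Π^tp_{Y̲_v} ⊆ P` (the
`Y`-half of abc-iut-w4-d010's `TemperedCoverings.YL_eq_of_characteristic`, which asks the same of `Ÿ̲` too).
[claim: Mochizuki2012, status: disputed] (IUTchII §2 Prop 2.1, kurims p.65) -/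
theorem TemperedCoverings.YL_eq_of_isTopCharacteristic_refY
    (hY : IsTopCharacteristic S.PiX (S.refY.comap S.inclPlain)) (T₁ T₂ : TemperedCoverings S P) :
    T₁.YL = T₂.YL := by
  obtain ⟨e₁, h₁, -⟩ := T₁.exists_mem_iff
  obtain ⟨e₂, h₂, -⟩ := T₂.exists_mem_iff
  refine Subgroup.ext fun x => ?_
  rw [h₁, h₂]
  -- the automorphism `e₁ ∘ e₂⁻¹` of `Π^tp_{X̲̲_v}` carries `e₂ x` to `e₁ x`
  have h := Subgroup.ext_iff.mp (hY (e₂.symm.trans e₁)) (e₁ x)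
  rw [Subgroup.mem_map_equiv, Subgroup.mem_comap, Subgroup.mem_comap] at h
  change S.inclPlain ((e₂.symm.trans e₁).symm (e₁ x)) ∈ S.refY ↔ _ at h
  rw [ContinuousMulEquiv.symm_trans_apply, ContinuousMulEquiv.symm_symm,
    ContinuousMulEquiv.symm_apply_apply] at h
  exact h.symm

end Generic

namespace BadPlaceSetting

variable {p : ℕ} [Fact p.Prime] {D : Literature.AnabelianGeometry.EtaleTheta.ThetaSetting p}
  {E : D.EtaleThetaData} {l : ℕ} (C : E.DoubleUnderline l) {N : ℕ+} (μ : D.CyclotomeMod l N)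
  (hC : D.Compat) (hS : D.Sec2Hyps) (hl : l.Prime) (hp2 : p ≠ 2) (hpl : p ≠ l)
  (hζ : ∃ ζ : D.K, IsPrimitiveRoot ζ (4 * l))
  {η : (C.thetaEnvData μ hC hS).PiYdd → MuN p N} (hη : η ∈ (C.thetaEnvData μ hC hS).thetaCocycles)

/-! ## 1. ROUTE A at the print-level model: modulo [EtTh] Cor. 2.18 (i) BY NAME -/

/-- Both anabelian hypotheses `hY`, `hYdd` of `TemperedCoverings.YL_eq_of_characteristic` hold at the
PRINT-LEVEL model bad-place setting `ofUnderline` MODULO [EtTh] Cor. 2.18 (i) (`RigidData.Cor218_i` for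
abc-iut-L2-t8's `C.rigidData μ hC hS h15 L`, a hypothesis BY NAME) — abc-iut-L6-t19's
`isTopCharacteristic_refY_refYdd_ofUnderline` ∘ abc-iut-w4-d013's `piYddCharacteristic_of_cor218_i`.
[claim: Mochizuki2012, status: disputed] (IUTchII §2 Prop 2.1, kurims p.65) -/
theorem isTopCharacteristic_refY_refYdd_ofUnderline_of_cor218_i (h15 : D.Prop15iii E hC)
    (L : C.CuspLabels) (R : RigidData.{0} N l) (hR : R = C.rigidData μ hC hS h15 L) (h218i : R.Cor218_i) :
    IsTopCharacteristic (ofUnderline C μ hC hS hl hp2 hpl hζ hη).PiX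
        ((ofUnderline C μ hC hS hl hp2 hpl hζ hη).refY.comap
          (ofUnderline C μ hC hS hl hp2 hpl hζ hη).inclPlain) ∧
      IsTopCharacteristic (ofUnderline C μ hC hS hl hp2 hpl hζ hη).PiX
        ((ofUnderline C μ hC hS hl hp2 hpl hζ hη).refYdd.comap
          (ofUnderline C μ hC hS hl hp2 hpl hζ hη).inclPlain) :=
  isTopCharacteristic_refY_refYdd_ofUnderline C μ hC hS hl hp2 hpl hζ hη
    (EtaleThetaDataOfSetting.piYddCharacteristic_of_cor218_i C μ hC hS h15 L R hR h218i)

/-- **[IUTchII] Prop. 2.1, well-definedness at the PRINT-LEVEL model (`Π^tp_{X_v} := Π^tp_{X̲_v}`,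
`[Π^tp_{X_v} : Π_v] = l`) MODULO [EtTh] Cor. 2.18 (i) BY NAME** ("may be reconstructed … from `Π^tp_{X̲̲_v}`",
kurims p. 65): any two Prop. 2.1 outputs over the same topological group `P` for `BadPlaceSetting.ofUnderline …`
have the same top row `Π^tp_{Ÿ̲_v} ⊆ Π^tp_{Y̲_v} ⊆ P`, granted the named FACT `Cor218_i` for abc-iut-L2-t8's
`C.rigidData …`. (The `(1,1)`-ambient form is abc-iut-w4-d034's `TemperedCoverings.YL_eq_of_cor218_i`.)
[claim: Mochizuki2012, status: disputed] (IUTchII §2 Prop 2.1, kurims p.65) -/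
theorem _root_.Literature.IUT.HodgeArakelov.TemperedCoverings.YL_eq_of_cor218_i' (h15 : D.Prop15iii E hC)
    (L : C.CuspLabels) (R : RigidData.{0} N l) (hR : R = C.rigidData μ hC hS h15 L) (h218i : R.Cor218_i)
    {P : TopGroup.{0}} (T₁ T₂ : TemperedCoverings (ofUnderline C μ hC hS hl hp2 hpl hζ hη) P) :
    T₁.YL = T₂.YL ∧ T₁.YddL = T₂.YddL :=
  TemperedCoverings.YL_eq_of_piYddCharacteristic' C μ hC hS hl hp2 hpl hζ hη
    (EtaleThetaDataOfSetting.piYddCharacteristic_of_cor218_i C μ hC hS h15 L R hR h218i) T₁ T₂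

/-! ## 2. ROUTE B at the print-level model: modulo [EtTh] Prop. 2.4 (i) at the model (binder `hP24`) -/

/-- **[IUTchII] Prop. 2.1 well-definedness at the PRINT-LEVEL model, from [EtTh] Prop. 2.4 (i) at the
model** (binder `hP24`, GAP-LEDGER G-L6d6-2 — the input the printed proof of Prop. 2.1 actually cites;
composition of abc-iut-L6-t19's `TemperedCoverings.YL_eq_of_piYddCharacteristic'` with abc-iut-L6-d6's
`EtaleThetaDataOfSetting.piYddCharacteristic_of_prop24`): any two Prop. 2.1 outputs over the same topological
group `P` have the same top row `Π^tp_{Ÿ̲_v} ⊆ Π^tp_{Y̲_v} ⊆ P`. (The `(1,1)`-ambient form is abc-iut-L6-d6's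
`TemperedCoverings.YL_eq_of_prop24Model`.)
[claim: Mochizuki2012, status: disputed] (IUTchII §2 Prop 2.1, kurims p.65) -/
theorem _root_.Literature.IUT.HodgeArakelov.TemperedCoverings.YL_eq_of_prop24Model'
    (hP24 : ∀ γ : C.Huu ≃ₜ* C.Huu, ∃ Γ : D.PiTemp ≃ₜ* D.PiTemp,
      (∀ h : C.Huu, (Γ h : D.PiTemp) = γ h) ∧ D.GtpYdd.map Γ.toMulEquiv.toMonoidHom = D.GtpYdd)
    {P : TopGroup.{0}} (T₁ T₂ : TemperedCoverings (ofUnderline C μ hC hS hl hp2 hpl hζ hη) P) :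
    T₁.YL = T₂.YL ∧ T₁.YddL = T₂.YddL :=
  TemperedCoverings.YL_eq_of_piYddCharacteristic' C μ hC hS hl hp2 hpl hζ hη
    (EtaleThetaDataOfSetting.piYddCharacteristic_of_prop24 C hP24) T₁ T₂

/-! ## 3. ROUTE C: the `Y`-row modulo only the compact-generation binder (no anabelian input) -/

/-- At BOTH model bad-place settings the reference subgroup `Π_v ∩ Π^tp_{Y_v}` is `Π^tp_Y̲̲ = Π^tp_Y ∩ Π^tp_X̲̲`
(abc-iut-L2-t8's `(C.thetaEnvData …).PiY`, definitionally `D.GtpY.subgroupOf C.Huu`); granted only that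
`Π^tp_{Y̲̲}` is topologically generated by the compact subgroups of `Π^tp_{X̲̲}` (binder `hYuu`, G-L6d6-1), it is
characteristic in the topological group `Π_v` — abc-iut-L6-d6's `map_GtpY_subgroupOf_eq_of_compactlyGenerated`,
NO extension to `Π^tp_X`, NO [EtTh] Prop. 2.4 / Cor. 2.18. Print-level model `ofUnderline`.
[claim: Mochizuki2012, status: disputed] (IUTchII §2 Prop 2.1, kurims p.65) -/
theorem isTopCharacteristic_refY_ofUnderline_of_compactlyGenerated
    (hYuu : D.GtpY.subgroupOf C.Huu ≤
      (Subgroup.closure {h : C.Huu | ∃ K : Subgroup C.Huu, IsCompact (K : Set C.Huu) ∧ h ∈ K}).topologicalClosure) :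
    IsTopCharacteristic (ofUnderline C μ hC hS hl hp2 hpl hζ hη).PiX
      ((ofUnderline C μ hC hS hl hp2 hpl hζ hη).refY.comap (ofUnderline C μ hC hS hl hp2 hpl hζ hη).inclPlain) :=
  fun φ => EtaleThetaDataOfSetting.map_GtpY_subgroupOf_eq_of_compactlyGenerated C hYuu φ

/-- The same at the `(1,1)`-ambient variant `ofDoubleUnderline` (same reference subgroup of `Π_v`).
[claim: Mochizuki2012, status: disputed] (IUTchII §2 Prop 2.1, kurims p.65) -/
theorem isTopCharacteristic_refY_ofDoubleUnderline_of_compactlyGenerated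
    (hYuu : D.GtpY.subgroupOf C.Huu ≤
      (Subgroup.closure {h : C.Huu | ∃ K : Subgroup C.Huu, IsCompact (K : Set C.Huu) ∧ h ∈ K}).topologicalClosure) :
    IsTopCharacteristic (ofDoubleUnderline C μ hC hS hl hp2 hpl hζ hη).PiX
      ((ofDoubleUnderline C μ hC hS hl hp2 hpl hζ hη).refY.comap
        (ofDoubleUnderline C μ hC hS hl hp2 hpl hζ hη).inclPlain) :=
  fun φ => EtaleThetaDataOfSetting.map_GtpY_subgroupOf_eq_of_compactlyGenerated C hYuu φ

/-- **[IUTchII] Prop. 2.1, the `Π^tp_{Y̲_v}`-ROW is well defined at the PRINT-LEVEL model modulo ONLY the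
compact-generation binder `hYuu` (G-L6d6-1)** — no anabelian input: any two Prop. 2.1 outputs over the same
topological group `P` for `BadPlaceSetting.ofUnderline …` have the same `Π^tp_{Y̲_v} ⊆ P`. (The `Ÿ̲`-row needs
(H1) — ROUTES A/B.) [claim: Mochizuki2012, status: disputed] (IUTchII §2 Prop 2.1, kurims p.65) -/
theorem _root_.Literature.IUT.HodgeArakelov.TemperedCoverings.YL_eq_of_compactlyGenerated'
    (hYuu : D.GtpY.subgroupOf C.Huu ≤
      (Subgroup.closure {h : C.Huu | ∃ K : Subgroup C.Huu, IsCompact (K : Set C.Huu) ∧ h ∈ K}).topologicalClosure)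
    {P : TopGroup.{0}} (T₁ T₂ : TemperedCoverings (ofUnderline C μ hC hS hl hp2 hpl hζ hη) P) :
    T₁.YL = T₂.YL :=
  TemperedCoverings.YL_eq_of_isTopCharacteristic_refY
    (isTopCharacteristic_refY_ofUnderline_of_compactlyGenerated C μ hC hS hl hp2 hpl hζ hη hYuu) T₁ T₂

/-- The same at the `(1,1)`-ambient variant `ofDoubleUnderline`.
[claim: Mochizuki2012, status: disputed] (IUTchII §2 Prop 2.1, kurims p.65) -/
theorem _root_.Literature.IUT.HodgeArakelov.TemperedCoverings.YL_eq_of_compactlyGenerated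
    (hYuu : D.GtpY.subgroupOf C.Huu ≤
      (Subgroup.closure {h : C.Huu | ∃ K : Subgroup C.Huu, IsCompact (K : Set C.Huu) ∧ h ∈ K}).topologicalClosure)
    {P : TopGroup.{0}} (T₁ T₂ : TemperedCoverings (ofDoubleUnderline C μ hC hS hl hp2 hpl hζ hη) P) :
    T₁.YL = T₂.YL :=
  TemperedCoverings.YL_eq_of_isTopCharacteristic_refY
    (isTopCharacteristic_refY_ofDoubleUnderline_of_compactlyGenerated C μ hC hS hl hp2 hpl hζ hη hYuu) T₁ T₂

end BadPlaceSetting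

end Literature.IUT.HodgeArakelov

end
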